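import Summits.CriticalPhenomena.PercolationContinuityZ3.Theorems.PercNearOneGluingNoHeavyLowerTailSahiGridPatternCoCountProductN
import Summits.CriticalPhenomena.PercolationContinuityZ3.Theorems.PercNearOneGluingNoHeavyLowerTailSahiGridPatternDiagCertBlockAndTheta
import Summits.CriticalPhenomena.PercolationContinuityZ3.Theorems.PercNearOneGluingNoHeavyLowerTailSahiGridPatternThreeStarPrelim
import Summits.CriticalPhenomena.PercolationContinuityZ3.Theorems.PercNearOneGluingNoHeavyLowerTailSahiGridPatternLiteralTwoAbsorb
import Summits.CriticalPhenomena.PercolationContinuityZ3.Theorems.PercNearOneGluingNoHeavyLowerTailSahiGridPatternDiagCertLift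

/-!
# `NoHeavyLowerTail` (crux stmt-CriticalPhenomena-4575), Sahi programme P1: **CONJECTURE A FOR THE FIRST NON-TOP-CUBE BLOCK `S = x ∨ y` AT
# CO-MONOTONE TEST PAIRS** — the co-count product of the recursive certificate of `{x ≥ 1} ∨ {y ≥ 1} ⊆ [3]²` with ANY boxed certificate of ANY
# up-set `V ⊆ [3]^k` satisfies condition (N) at every pair of up-sets whose sections are co-monotone on the nine incomparable outer cell pairs (every `k`)

Support file (Sahi cell, seat `prim-sahi-p1`, generation 40; `--supports stmt-CriticalPhenomena-4575`).  Pure proofs, no definitions, no `sorry`, standard axioms.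
Vocabulary of `…SahiGridPattern{,CellForm,DiagCert,DiagCertBlockAndTheta,CoCountProductT,CoCountProductN,ThreeStarPrelim,DiagCertLift}` (`Pd`, `glue`, `sect`,
`freeOf`, `cellOf`, `ind`, `thetaVal`, `lamU`, `theta_blockAnd_le`, `diagCert_coProduct_T`, `sum_glue`, `sum_pd1`, `pd1_facts`, `sect_inter`).

THE MATHEMATICS (seat memo FROM-prim-sahi-p1-gen40 §2).  CONJECTURE A (memo gen34 §2.5) asks that the co-count product
`d'(x) = 2^{n+k+1}1_S(ξ)1_V(q) − m_S(ξ)m_V(q)` (`x = glue ξ q`, `m_X = 2^{dim+1}1_X − d_X`) of two diagonal certificates satisfy (N) for `S × V`; it is a theorem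
for TOP-CUBE `S` (`…CoCountProductN`).  The first block that is not a top cube is the two-clause `S = {x ≥ 1} ∨ {y ≥ 1} ⊆ [3]²` with its recursive (OR8) certificate
`c = (c(0,0), c(0,t≥1), c(s≥1,0), c(T)) = (0, 4, 2, 5)`; its co-count product with `d_V` is `e(glue σ q) = 2^{k+1}(c(σ) − 4)1_V(q) + (8 − c(σ))d_V(q)`.
Write `P^σ, Q^σ ⊆ [3]^k` for the sections of the test sets at the outer cell `σ ∈ [3]²`.  By `theta_blockAnd_le`,
`Θ_{S×V}(P×Q) ≤ Σ_{σ δ̸ σ'} Θ_S(σ,σ')·Θ_V(P^σ × Q^{σ'})`, and for `S = x∨y` the weights `Θ_S` are `1` on the 24 ordered totally distinct pairs inside `S` that are not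
antipodal in the top cube `T = {1,2}²`, `2` on the four antipodal `T`-pairs and `0` on the eight pairs through the corner `(0,0)` (`thetaWeight_orTwo_expand`).
For a NESTED pair of sections (`P^σ ⊆ P^{σ'}`, `Q^σ ⊆ Q^{σ'}`) two instances of (N) for `V` and modularity of `d_V ≥ 0` give the CROSSED-ROUTE bound
`Θ_V(P^σ×Q^{σ'}) + Θ_V(P^{σ'}×Q^σ) ≤ d_V(P^σ∩Q^σ) + d_V(P^{σ'}∩Q^{σ'})` (`theta_pair_le_of_nested`).  Sections of up-sets are nested along comparable cells
(`sect_mono`); on the nine INCOMPARABLE cell pairs of `[3]²` we ASSUME co-monotonicity (one of the two nestings).  Then every outer cell of `S` is charged exactly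
four times, and the remaining budget `Σ_{σ∈T} m_V(W_σ) − 2m_V(W_{10}) − 2m_V(W_{20})` (`W_σ = P^σ∩Q^σ`, `m_V = 2^{k+1}1_V − d_V ≥ 0` by the box) is nonnegative because
`W_{10} ⊆ W_{11}, W_{12}` and `W_{20} ⊆ W_{21}, W_{22}`.
**THEOREM (`diagCert_coProduct_N_orTwo_of_comonotone`, every `k`).**  For every up-set `V ⊆ [3]^k` and every `d_V ≥ 0` with (N) for `V` and `d_V ≤ 2^{k+1}1_V`, the
co-count product `e` satisfies `Θ_{S×V}(P×Q) ≤ e(P∩Q)` at every pair of up-sets `P, Q ⊆ [3]^{2+k}` that is CO-MONOTONE on the nine incomparable cell pairs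
(hypotheses `h0110 … h1221`: on each such pair `{σ,σ'}` either `P^σ ⊆ P^{σ'} ∧ Q^σ ⊆ Q^{σ'}` or the reverse) — e.g. every pair `(P,Q)` both of whose section maps
depend on the first outer coordinate only, or both on the second only.
**COROLLARY (`sStarD_blockAnd_orTwo_nonneg_of_comonotone`).**  With (T) for `d_V` in addition, `0 ≤ sStarD ((x∨y)×V) P Q` at every such pair.
REMARK (memo §2.3–2.5): at general test pairs the same bookkeeping leaves exactly the nine "uncrossing" terms `Θ_V((P^σ∖P^{σ'})×(Q^{σ'}∖Q^σ)) + Θ_V((P^{σ'}∖P^σ)×(Q^σ∖Q^{σ'}))`;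
the seat's LP hunts (k ≤ 4, exact certification) found no violation of Conjecture A for this block, but also no test-pair-oblivious routing.  Nothing here asserts
Conjecture A in general or `PatternPos d` for `d ≥ 4`. [this work]
-/

namespace Summit.CriticalPhenomena.PercolationContinuityZ3.Theorems.SahiGridPattern

open Finset SahiGrid3
open scoped BigOperators

variable {k : ℕ}

/-! ### Small tools -/

/-- The indicator of an up-set is monotone. [this work] -/
theorem ind_mono_of_isUpperSet {d : ℕ} {P : Finset (Pd d)} (hP : IsUpperSet (P : Set (Pd d))) {x y : Pd d} (hxy : x ≤ y) :
    ind P x ≤ ind P y := by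
  unfold ind
  by_cases hx : x ∈ P
  · have hy : y ∈ P := hP hxy hx
    rw [if_pos hx, if_pos hy]
  · rw [if_neg hx]
    split_ifs <;> norm_num

/-- Sections of an up-set grow along the outer order: `ξ ≤ ξ' ⟹ P^ξ ⊆ P^{ξ'}`. [this work] -/
theorem sect_mono {n : ℕ} {P : Finset (Pd (n + k))} (hP : IsUpperSet (P : Set (Pd (n + k)))) {ξ ξ' : Pd n} (h : ξ ≤ ξ') :
    sect P ξ ⊆ sect P ξ' := by
  intro q hq
  unfold sect at hq ⊢
  rw [mem_filter] at hq ⊢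
  exact ⟨mem_univ _, hP (glue_le_glue_iff.2 ⟨h, le_rfl⟩) hq.2⟩

/-- **The crossed-route bound**: for nested up-sets `X ⊆ X'`, `Y ⊆ Y'` of `[3]^k`, a vector `d ≥ 0` with condition (N) for `V` pays the two crossed
rectangles from the two diagonal meets: `Θ_V(X×Y') + Θ_V(X'×Y) ≤ d(X∩Y) + d(X'∩Y')` (two instances of (N), then modularity of `d` and `d ≥ 0`:
the footprints `X∩Y'`, `X'∩Y` have union inside `X'∩Y'` and intersection inside `X∩Y`). [this work] -/
theorem theta_pair_le_of_nested {V : Finset (Pd k)} (d : Pd k → ℤ) (hd0 : ∀ q, 0 ≤ d q)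
    (hN : ∀ X X' : Finset (Pd k), IsUpperSet (X : Set (Pd k)) → IsUpperSet (X' : Set (Pd k)) →
      (∑ q ∈ X, ∑ r ∈ X', thetaVal V q r) ≤ ∑ q ∈ X ∩ X', d q)
    {X X' Y Y' : Finset (Pd k)} (hX : IsUpperSet (X : Set (Pd k))) (hX' : IsUpperSet (X' : Set (Pd k)))
    (hY : IsUpperSet (Y : Set (Pd k))) (hY' : IsUpperSet (Y' : Set (Pd k))) (hXX : X ⊆ X') (hYY : Y ⊆ Y') :
    (∑ q ∈ X, ∑ r ∈ Y', thetaVal V q r) + (∑ q ∈ X', ∑ r ∈ Y, thetaVal V q r) ≤ (∑ q ∈ X ∩ Y, d q) + ∑ q ∈ X' ∩ Y', d q := by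
  have h1 := hN X Y' hX hY'
  have h2 := hN X' Y hX' hY
  have hui : (∑ q ∈ (X ∩ Y') ∪ (X' ∩ Y), d q) + (∑ q ∈ (X ∩ Y') ∩ (X' ∩ Y), d q) = (∑ q ∈ X ∩ Y', d q) + ∑ q ∈ X' ∩ Y, d q :=
    Finset.sum_union_inter
  have hsub1 : (X ∩ Y') ∪ (X' ∩ Y) ⊆ X' ∩ Y' := by
    intro q hq
    rw [Finset.mem_union, Finset.mem_inter, Finset.mem_inter] at hq
    rw [Finset.mem_inter]
    rcases hq with ⟨h1q, h2q⟩ | ⟨h1q, h2q⟩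
    · exact ⟨hXX h1q, h2q⟩
    · exact ⟨h1q, hYY h2q⟩
  have hsub2 : (X ∩ Y') ∩ (X' ∩ Y) ⊆ X ∩ Y := by
    intro q hq
    rw [Finset.mem_inter, Finset.mem_inter, Finset.mem_inter] at hq
    rw [Finset.mem_inter]
    exact ⟨hq.1.1, hq.2.2⟩
  have e1 := Finset.sum_le_sum_of_subset_of_nonneg hsub1 (fun q _ _ => hd0 q)
  have e2 := Finset.sum_le_sum_of_subset_of_nonneg hsub2 (fun q _ _ => hd0 q)
  linarith

/-- A weighted diagonal cell sum grows along the outer order (up-sets `P, Q`, weight `g ≥ 0`). [this work] -/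
theorem cell_sum_mono {n : ℕ} {P Q : Finset (Pd (n + k))} (hP : IsUpperSet (P : Set (Pd (n + k)))) (hQ : IsUpperSet (Q : Set (Pd (n + k))))
    (g : Pd k → ℤ) (hg : ∀ q, 0 ≤ g q) {σ σ' : Pd n} (h : σ ≤ σ') :
    (∑ q : Pd k, ind P (glue σ q) * ind Q (glue σ q) * g q) ≤ ∑ q : Pd k, ind P (glue σ' q) * ind Q (glue σ' q) * g q := by
  refine Finset.sum_le_sum fun q _ => ?_
  have hle : glue σ q ≤ glue σ' q := glue_le_glue_iff.2 ⟨h, le_rfl⟩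
  have hp := ind_mono_of_isUpperSet hP hle
  have hq' := ind_mono_of_isUpperSet hQ hle
  have hp0 := ind_nonneg' P (glue σ q)
  have hq0 := ind_nonneg' Q (glue σ' q)
  calc ind P (glue σ q) * ind Q (glue σ q) * g q ≤ ind P (glue σ q) * ind Q (glue σ' q) * g q := by
        apply mul_le_mul_of_nonneg_right (mul_le_mul_of_nonneg_left hq' hp0) (hg q)
    _ ≤ ind P (glue σ' q) * ind Q (glue σ' q) * g q := by
        apply mul_le_mul_of_nonneg_right (mul_le_mul_of_nonneg_right hp hq0) (hg q)

/-! ### The two-clause block `S = {x ≥ 1} ∨ {y ≥ 1} ⊆ [3]²` -/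

section OrTwo

variable {S : Finset (Pd (1 + 1))} {V : Finset (Pd k)} {A : Finset (Pd ((1 + 1) + k))}

/-- The nine values of `1_S` on the outer cells (`0` at the corner `(0,0)`, `1` elsewhere). [this work] -/
theorem ind_orTwo_vals (hS : ∀ ξ η : Pd 1, glue ξ η ∈ S ↔ (1 ≤ ξ 0 ∨ 1 ≤ η 0)) :
    ind S (glue (fun _ => 0) (fun _ => 0)) = 0 ∧ ind S (glue (fun _ => 0) (fun _ => 1)) = 1 ∧ ind S (glue (fun _ => 0) (fun _ => 2)) = 1 ∧
    ind S (glue (fun _ => 1) (fun _ => 0)) = 1 ∧ ind S (glue (fun _ => 1) (fun _ => 1)) = 1 ∧ ind S (glue (fun _ => 1) (fun _ => 2)) = 1 ∧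
    ind S (glue (fun _ => 2) (fun _ => 0)) = 1 ∧ ind S (glue (fun _ => 2) (fun _ => 1)) = 1 ∧ ind S (glue (fun _ => 2) (fun _ => 2)) = 1 := by
  have f11 : (1:Fin 3) ≤ 1 := le_rfl
  have f12 : (1:Fin 3) ≤ 2 := by decide
  have f10 : ¬ (1:Fin 3) ≤ 0 := by decide
  unfold ind
  simp only [hS, f11, f12, f10, or_true, or_false, if_true, if_false, and_self]

/-- **The `Θ_S`-weighted pair sum for `S = x∨y`, written out**: the 28 totally distinct outer pairs with nonzero weight (`1` inside `S` off the antipodal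
`T`-pairs, `2` on the four antipodal `T`-pairs; the eight pairs through the corner have weight `0`). Any kernel `T`. [this work] -/
theorem thetaWeight_orTwo_expand (hS : ∀ ξ η : Pd 1, glue ξ η ∈ S ↔ (1 ≤ ξ 0 ∨ 1 ≤ η 0)) (T : Pd (1 + 1) → Pd (1 + 1) → ℤ) :
    (∑ x : Pd (1 + 1), ∑ y : Pd (1 + 1), thetaVal S x y * T x y) =
      T (glue (fun _ => 0) (fun _ => 1)) (glue (fun _ => 1) (fun _ => 0))
      + T (glue (fun _ => 0) (fun _ => 1)) (glue (fun _ => 1) (fun _ => 2))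
      + T (glue (fun _ => 0) (fun _ => 1)) (glue (fun _ => 2) (fun _ => 0))
      + T (glue (fun _ => 0) (fun _ => 1)) (glue (fun _ => 2) (fun _ => 2))
      + T (glue (fun _ => 0) (fun _ => 2)) (glue (fun _ => 1) (fun _ => 0))
      + T (glue (fun _ => 0) (fun _ => 2)) (glue (fun _ => 1) (fun _ => 1))
      + T (glue (fun _ => 0) (fun _ => 2)) (glue (fun _ => 2) (fun _ => 0))
      + T (glue (fun _ => 0) (fun _ => 2)) (glue (fun _ => 2) (fun _ => 1))
      + T (glue (fun _ => 1) (fun _ => 0)) (glue (fun _ => 0) (fun _ => 1))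
      + T (glue (fun _ => 1) (fun _ => 0)) (glue (fun _ => 0) (fun _ => 2))
      + T (glue (fun _ => 1) (fun _ => 0)) (glue (fun _ => 2) (fun _ => 1))
      + T (glue (fun _ => 1) (fun _ => 0)) (glue (fun _ => 2) (fun _ => 2))
      + T (glue (fun _ => 1) (fun _ => 1)) (glue (fun _ => 0) (fun _ => 2))
      + T (glue (fun _ => 1) (fun _ => 1)) (glue (fun _ => 2) (fun _ => 0))
      + 2 * T (glue (fun _ => 1) (fun _ => 1)) (glue (fun _ => 2) (fun _ => 2))
      + T (glue (fun _ => 1) (fun _ => 2)) (glue (fun _ => 0) (fun _ => 1))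
      + T (glue (fun _ => 1) (fun _ => 2)) (glue (fun _ => 2) (fun _ => 0))
      + 2 * T (glue (fun _ => 1) (fun _ => 2)) (glue (fun _ => 2) (fun _ => 1))
      + T (glue (fun _ => 2) (fun _ => 0)) (glue (fun _ => 0) (fun _ => 1))
      + T (glue (fun _ => 2) (fun _ => 0)) (glue (fun _ => 0) (fun _ => 2))
      + T (glue (fun _ => 2) (fun _ => 0)) (glue (fun _ => 1) (fun _ => 1))
      + T (glue (fun _ => 2) (fun _ => 0)) (glue (fun _ => 1) (fun _ => 2))
      + T (glue (fun _ => 2) (fun _ => 1)) (glue (fun _ => 0) (fun _ => 2))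
      + T (glue (fun _ => 2) (fun _ => 1)) (glue (fun _ => 1) (fun _ => 0))
      + 2 * T (glue (fun _ => 2) (fun _ => 1)) (glue (fun _ => 1) (fun _ => 2))
      + T (glue (fun _ => 2) (fun _ => 2)) (glue (fun _ => 0) (fun _ => 1))
      + T (glue (fun _ => 2) (fun _ => 2)) (glue (fun _ => 1) (fun _ => 0))
      + 2 * T (glue (fun _ => 2) (fun _ => 2)) (glue (fun _ => 1) (fun _ => 1)) := by
  obtain ⟨h00, h11, h22, h01, h02, h10, h12, h20, h21, t01, t02, t10, t12, t20, t21⟩ := pd1_facts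
  obtain ⟨u00, u01, u02, u10, u11, u12, u20, u21, u22⟩ := ind_orTwo_vals hS
  simp only [sum_glue (n := 1) (k := 1), sum_pd1, thetaVal_eq_ite_mul, ite_totDist_glue, thirdPt_glue,
    h00, h11, h22, h01, h02, h10, h12, h20, h21, t01, t02, t10, t12, t20, t21,
    u00, u01, u02, u10, u11, u12, u20, u21, u22,
    Bool.false_eq_true, if_false, if_true, zero_mul, mul_zero, one_mul, zero_add, add_zero]
  ring

/-- **THEOREM (Conjecture A for `S = x ∨ y` at co-monotone test pairs; every `k`).**  `S = {x≥1} ∨ {y≥1} ⊆ [3]²` (hypothesis `hS`), `dS` its recursive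
certificate (`hdS`: values `0 | 4 | 2 | 5` on the corner, the cells `(0,t≥1)`, the cells `(s≥1,0)`, the top cube), `A = S × V`, `V` an up-set with `d_V ≥ 0`,
(N) for `V` and the box `d_V ≤ 2^{k+1}1_V`.  Then the co-count product satisfies (N) at every pair of up-sets `P, Q ⊆ [3]^{2+k}` that is co-monotone on the nine
incomparable outer cell pairs. [this work] -/
theorem diagCert_coProduct_N_orTwo_of_comonotone (hS : ∀ ξ η : Pd 1, glue ξ η ∈ S ↔ (1 ≤ ξ 0 ∨ 1 ≤ η 0))
    (hSu : IsUpperSet (S : Set (Pd (1 + 1)))) (hV : IsUpperSet (V : Set (Pd k))) (hA : ∀ σ z, glue σ z ∈ A ↔ (σ ∈ S ∧ z ∈ V))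
    (dS : Pd (1 + 1) → ℤ) (hdS : dS (glue (fun _ => 0) (fun _ => 0)) = 0 ∧ dS (glue (fun _ => 0) (fun _ => 1)) = 4 ∧ dS (glue (fun _ => 0) (fun _ => 2)) = 4 ∧
      dS (glue (fun _ => 1) (fun _ => 0)) = 2 ∧ dS (glue (fun _ => 1) (fun _ => 1)) = 5 ∧ dS (glue (fun _ => 1) (fun _ => 2)) = 5 ∧
      dS (glue (fun _ => 2) (fun _ => 0)) = 2 ∧ dS (glue (fun _ => 2) (fun _ => 1)) = 5 ∧ dS (glue (fun _ => 2) (fun _ => 2)) = 5)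
    (dV : Pd k → ℤ) (hdV : ∀ q, 0 ≤ dV q) (hmV : ∀ q : Pd k, dV q ≤ 2 * (2:ℤ) ^ k * ind V q)
    (hNV : ∀ X X' : Finset (Pd k), IsUpperSet (X : Set (Pd k)) → IsUpperSet (X' : Set (Pd k)) → (∑ q ∈ X, ∑ r ∈ X', thetaVal V q r) ≤ ∑ q ∈ X ∩ X', dV q)
    {P Q : Finset (Pd ((1 + 1) + k))} (hP : IsUpperSet (P : Set (Pd ((1 + 1) + k)))) (hQ : IsUpperSet (Q : Set (Pd ((1 + 1) + k))))
    (h0110 : (sect P (glue (fun _ => 0) (fun _ => 1)) ⊆ sect P (glue (fun _ => 1) (fun _ => 0)) ∧ sect Q (glue (fun _ => 0) (fun _ => 1)) ⊆ sect Q (glue (fun _ => 1) (fun _ => 0))) ∨ (sect P (glue (fun _ => 1) (fun _ => 0)) ⊆ sect P (glue (fun _ => 0) (fun _ => 1)) ∧ sect Q (glue (fun _ => 1) (fun _ => 0)) ⊆ sect Q (glue (fun _ => 0) (fun _ => 1))))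
    (h0120 : (sect P (glue (fun _ => 0) (fun _ => 1)) ⊆ sect P (glue (fun _ => 2) (fun _ => 0)) ∧ sect Q (glue (fun _ => 0) (fun _ => 1)) ⊆ sect Q (glue (fun _ => 2) (fun _ => 0))) ∨ (sect P (glue (fun _ => 2) (fun _ => 0)) ⊆ sect P (glue (fun _ => 0) (fun _ => 1)) ∧ sect Q (glue (fun _ => 2) (fun _ => 0)) ⊆ sect Q (glue (fun _ => 0) (fun _ => 1))))
    (h0210 : (sect P (glue (fun _ => 0) (fun _ => 2)) ⊆ sect P (glue (fun _ => 1) (fun _ => 0)) ∧ sect Q (glue (fun _ => 0) (fun _ => 2)) ⊆ sect Q (glue (fun _ => 1) (fun _ => 0))) ∨ (sect P (glue (fun _ => 1) (fun _ => 0)) ⊆ sect P (glue (fun _ => 0) (fun _ => 2)) ∧ sect Q (glue (fun _ => 1) (fun _ => 0)) ⊆ sect Q (glue (fun _ => 0) (fun _ => 2))))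
    (h0211 : (sect P (glue (fun _ => 0) (fun _ => 2)) ⊆ sect P (glue (fun _ => 1) (fun _ => 1)) ∧ sect Q (glue (fun _ => 0) (fun _ => 2)) ⊆ sect Q (glue (fun _ => 1) (fun _ => 1))) ∨ (sect P (glue (fun _ => 1) (fun _ => 1)) ⊆ sect P (glue (fun _ => 0) (fun _ => 2)) ∧ sect Q (glue (fun _ => 1) (fun _ => 1)) ⊆ sect Q (glue (fun _ => 0) (fun _ => 2))))
    (h0220 : (sect P (glue (fun _ => 0) (fun _ => 2)) ⊆ sect P (glue (fun _ => 2) (fun _ => 0)) ∧ sect Q (glue (fun _ => 0) (fun _ => 2)) ⊆ sect Q (glue (fun _ => 2) (fun _ => 0))) ∨ (sect P (glue (fun _ => 2) (fun _ => 0)) ⊆ sect P (glue (fun _ => 0) (fun _ => 2)) ∧ sect Q (glue (fun _ => 2) (fun _ => 0)) ⊆ sect Q (glue (fun _ => 0) (fun _ => 2))))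
    (h0221 : (sect P (glue (fun _ => 0) (fun _ => 2)) ⊆ sect P (glue (fun _ => 2) (fun _ => 1)) ∧ sect Q (glue (fun _ => 0) (fun _ => 2)) ⊆ sect Q (glue (fun _ => 2) (fun _ => 1))) ∨ (sect P (glue (fun _ => 2) (fun _ => 1)) ⊆ sect P (glue (fun _ => 0) (fun _ => 2)) ∧ sect Q (glue (fun _ => 2) (fun _ => 1)) ⊆ sect Q (glue (fun _ => 0) (fun _ => 2))))
    (h1120 : (sect P (glue (fun _ => 1) (fun _ => 1)) ⊆ sect P (glue (fun _ => 2) (fun _ => 0)) ∧ sect Q (glue (fun _ => 1) (fun _ => 1)) ⊆ sect Q (glue (fun _ => 2) (fun _ => 0))) ∨ (sect P (glue (fun _ => 2) (fun _ => 0)) ⊆ sect P (glue (fun _ => 1) (fun _ => 1)) ∧ sect Q (glue (fun _ => 2) (fun _ => 0)) ⊆ sect Q (glue (fun _ => 1) (fun _ => 1))))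
    (h1220 : (sect P (glue (fun _ => 1) (fun _ => 2)) ⊆ sect P (glue (fun _ => 2) (fun _ => 0)) ∧ sect Q (glue (fun _ => 1) (fun _ => 2)) ⊆ sect Q (glue (fun _ => 2) (fun _ => 0))) ∨ (sect P (glue (fun _ => 2) (fun _ => 0)) ⊆ sect P (glue (fun _ => 1) (fun _ => 2)) ∧ sect Q (glue (fun _ => 2) (fun _ => 0)) ⊆ sect Q (glue (fun _ => 1) (fun _ => 2))))
    (h1221 : (sect P (glue (fun _ => 1) (fun _ => 2)) ⊆ sect P (glue (fun _ => 2) (fun _ => 1)) ∧ sect Q (glue (fun _ => 1) (fun _ => 2)) ⊆ sect Q (glue (fun _ => 2) (fun _ => 1))) ∨ (sect P (glue (fun _ => 2) (fun _ => 1)) ⊆ sect P (glue (fun _ => 1) (fun _ => 2)) ∧ sect Q (glue (fun _ => 2) (fun _ => 1)) ⊆ sect Q (glue (fun _ => 1) (fun _ => 2)))) :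
    (∑ x ∈ P, ∑ y ∈ Q, thetaVal A x y) ≤ ∑ x ∈ P ∩ Q, (2 * (2:ℤ) ^ ((1 + 1) + k) * (ind S (freeOf x) * ind V (cellOf x))
        - (2 * (2:ℤ) ^ (1 + 1) * ind S (freeOf x) - dS (freeOf x)) * (2 * (2:ℤ) ^ k * ind V (cellOf x) - dV (cellOf x))) := by
  obtain ⟨s00, s01, s02, s10, s11, s12, s20, s21, s22⟩ := hdS
  obtain ⟨u00, u01, u02, u10, u11, u12, u20, u21, u22⟩ := ind_orTwo_vals hS
  have f01 : ((fun _ => (0:Fin 3)) : Pd 1) ≤ (fun _ => 1) := fun _ => (by decide : (0:Fin 3) ≤ 1)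
  have f02 : ((fun _ => (0:Fin 3)) : Pd 1) ≤ (fun _ => 2) := fun _ => (by decide : (0:Fin 3) ≤ 2)
  have f12 : ((fun _ => (1:Fin 3)) : Pd 1) ≤ (fun _ => 2) := fun _ => (by decide : (1:Fin 3) ≤ 2)
  have f00 : ((fun _ => (0:Fin 3)) : Pd 1) ≤ (fun _ => 0) := le_rfl
  have f11 : ((fun _ => (1:Fin 3)) : Pd 1) ≤ (fun _ => 1) := le_rfl
  have f22 : ((fun _ => (2:Fin 3)) : Pd 1) ≤ (fun _ => 2) := le_rfl
  -- cell order facts `glue a b ≤ glue a' b'` for the comparable pairs used below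
  have cle : ∀ {a b a' b' : Pd 1}, a ≤ a' → b ≤ b' → (glue a b : Pd (1 + 1)) ≤ glue a' b' := fun ha hb => glue_le_glue_iff.2 ⟨ha, hb⟩
  -- Step 1: Θ-domination by the S-weighted section pairs
  have hdom := theta_blockAnd_le hA hSu hV hP hQ
  rw [thetaWeight_orTwo_expand hS] at hdom
  -- abbreviations for the section data
  have hsP : ∀ σ : Pd (1 + 1), IsUpperSet ((sect P σ : Finset (Pd k)) : Set (Pd k)) := fun σ => isUpperSet_sect hP σ
  have hsQ : ∀ σ : Pd (1 + 1), IsUpperSet ((sect Q σ : Finset (Pd k)) : Set (Pd k)) := fun σ => isUpperSet_sect hQ σ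
  -- Step 2: the fourteen pair bounds (crossed route), nestedness from `sect_mono` or from the co-monotonicity hypotheses; diagonal meets as cell sums
  have hD : ∀ σ : Pd (1 + 1), (∑ q ∈ sect P σ ∩ sect Q σ, dV q) = ∑ q : Pd k, ind P (glue σ q) * ind Q (glue σ q) * dV q :=
    fun σ => sum_mem_sect_inter_eq dV P Q σ σ
  have pb : ∀ σ σ' : Pd (1 + 1), ((sect P σ ⊆ sect P σ' ∧ sect Q σ ⊆ sect Q σ') ∨ (sect P σ' ⊆ sect P σ ∧ sect Q σ' ⊆ sect Q σ)) →
      (∑ q ∈ sect P σ, ∑ r ∈ sect Q σ', thetaVal V q r) + (∑ q ∈ sect P σ', ∑ r ∈ sect Q σ, thetaVal V q r)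
        ≤ (∑ q : Pd k, ind P (glue σ q) * ind Q (glue σ q) * dV q) + ∑ q : Pd k, ind P (glue σ' q) * ind Q (glue σ' q) * dV q := by
    intro σ σ' h
    rw [← hD σ, ← hD σ']
    rcases h with ⟨h1, h2⟩ | ⟨h1, h2⟩
    · exact theta_pair_le_of_nested dV hdV hNV (hsP σ) (hsP σ') (hsQ σ) (hsQ σ') h1 h2
    · have := theta_pair_le_of_nested dV hdV hNV (hsP σ') (hsP σ) (hsQ σ') (hsQ σ) h1 h2
      linarith
  have nest : ∀ σ σ' : Pd (1 + 1), σ ≤ σ' → ((sect P σ ⊆ sect P σ' ∧ sect Q σ ⊆ sect Q σ') ∨ (sect P σ' ⊆ sect P σ ∧ sect Q σ' ⊆ sect Q σ)) :=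
    fun σ σ' h => Or.inl ⟨sect_mono hP h, sect_mono hQ h⟩
  have p0110 := pb (glue (fun _ => 0) (fun _ => 1)) (glue (fun _ => 1) (fun _ => 0)) h0110
  have p0112 := pb (glue (fun _ => 0) (fun _ => 1)) (glue (fun _ => 1) (fun _ => 2)) (nest _ _ (cle f01 f12))
  have p0120 := pb (glue (fun _ => 0) (fun _ => 1)) (glue (fun _ => 2) (fun _ => 0)) h0120
  have p0122 := pb (glue (fun _ => 0) (fun _ => 1)) (glue (fun _ => 2) (fun _ => 2)) (nest _ _ (cle f02 f12))
  have p0210 := pb (glue (fun _ => 0) (fun _ => 2)) (glue (fun _ => 1) (fun _ => 0)) h0210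
  have p0211 := pb (glue (fun _ => 0) (fun _ => 2)) (glue (fun _ => 1) (fun _ => 1)) h0211
  have p0220 := pb (glue (fun _ => 0) (fun _ => 2)) (glue (fun _ => 2) (fun _ => 0)) h0220
  have p0221 := pb (glue (fun _ => 0) (fun _ => 2)) (glue (fun _ => 2) (fun _ => 1)) h0221
  have p1021 := pb (glue (fun _ => 1) (fun _ => 0)) (glue (fun _ => 2) (fun _ => 1)) (nest _ _ (cle f12 f01))
  have p1022 := pb (glue (fun _ => 1) (fun _ => 0)) (glue (fun _ => 2) (fun _ => 2)) (nest _ _ (cle f12 f02))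
  have p1120 := pb (glue (fun _ => 1) (fun _ => 1)) (glue (fun _ => 2) (fun _ => 0)) h1120
  have p1122 := pb (glue (fun _ => 1) (fun _ => 1)) (glue (fun _ => 2) (fun _ => 2)) (nest _ _ (cle f12 f12))
  have p1220 := pb (glue (fun _ => 1) (fun _ => 2)) (glue (fun _ => 2) (fun _ => 0)) h1220
  have p1221 := pb (glue (fun _ => 1) (fun _ => 2)) (glue (fun _ => 2) (fun _ => 1)) h1221
  -- Step 3: the budget `e(P∩Q)` by cells
  have hbud : (∑ x ∈ P ∩ Q, (2 * (2:ℤ) ^ ((1 + 1) + k) * (ind S (freeOf x) * ind V (cellOf x))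
      - (2 * (2:ℤ) ^ (1 + 1) * ind S (freeOf x) - dS (freeOf x)) * (2 * (2:ℤ) ^ k * ind V (cellOf x) - dV (cellOf x))))
      = ∑ σ : Pd (1 + 1), ∑ q : Pd k, ind P (glue σ q) * ind Q (glue σ q) *
          (2 * (2:ℤ) ^ ((1 + 1) + k) * (ind S σ * ind V q) - (2 * (2:ℤ) ^ (1 + 1) * ind S σ - dS σ) * (2 * (2:ℤ) ^ k * ind V q - dV q)) := by
    rw [sum_mem_eq_sum_glue]
    refine Finset.sum_congr rfl fun σ _ => Finset.sum_congr rfl fun q _ => ?_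
    rw [ind_inter_eq_mul, freeOf_glue, cellOf_glue]
  -- per-cell budget as `α·(2^k·M(σ)) + m·D(σ)` with `M(σ) = Σ_q 1_P 1_Q 1_V`, `D(σ) = Σ_q 1_P 1_Q d_V`
  have hcell : ∀ (σ : Pd (1 + 1)) (s t : ℤ), ind S σ = s → dS σ = t →
      (∑ q : Pd k, ind P (glue σ q) * ind Q (glue σ q) *
          (2 * (2:ℤ) ^ ((1 + 1) + k) * (ind S σ * ind V q) - (2 * (2:ℤ) ^ (1 + 1) * ind S σ - dS σ) * (2 * (2:ℤ) ^ k * ind V q - dV q)))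
        = (2 * t - 8 * s) * ((2:ℤ) ^ k * ∑ q : Pd k, ind P (glue σ q) * ind Q (glue σ q) * ind V q)
          + (8 * s - t) * (∑ q : Pd k, ind P (glue σ q) * ind Q (glue σ q) * dV q) := by
    intro σ s t hs ht
    rw [Finset.mul_sum, Finset.mul_sum, Finset.mul_sum, ← Finset.sum_add_distrib]
    refine Finset.sum_congr rfl fun q _ => ?_
    rw [hs, ht, pow_add, pow_add, pow_one]
    ring
  -- the remaining budget: `m_V`-weighted cells grow along the outer order (box ⟹ m_V ≥ 0)
  have hm0 : ∀ q : Pd k, 0 ≤ 2 * (2:ℤ) ^ k * ind V q - dV q := fun q => by linarith [hmV q]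
  have gsplit : ∀ σ : Pd (1 + 1), (∑ q : Pd k, ind P (glue σ q) * ind Q (glue σ q) * (2 * (2:ℤ) ^ k * ind V q - dV q))
      = 2 * ((2:ℤ) ^ k * ∑ q : Pd k, ind P (glue σ q) * ind Q (glue σ q) * ind V q) - ∑ q : Pd k, ind P (glue σ q) * ind Q (glue σ q) * dV q := by
    intro σ
    rw [Finset.mul_sum, Finset.mul_sum, ← Finset.sum_sub_distrib]
    refine Finset.sum_congr rfl fun q _ => ?_
    ring
  have gm : ∀ σ σ' : Pd (1 + 1), σ ≤ σ' →
      2 * ((2:ℤ) ^ k * ∑ q : Pd k, ind P (glue σ q) * ind Q (glue σ q) * ind V q) - (∑ q : Pd k, ind P (glue σ q) * ind Q (glue σ q) * dV q)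
        ≤ 2 * ((2:ℤ) ^ k * ∑ q : Pd k, ind P (glue σ' q) * ind Q (glue σ' q) * ind V q) - ∑ q : Pd k, ind P (glue σ' q) * ind Q (glue σ' q) * dV q := by
    intro σ σ' h
    have h1 := cell_sum_mono hP hQ _ hm0 h
    have e1 := gsplit σ
    have e2 := gsplit σ'
    linarith
  have g1011 := gm (glue (fun _ => 1) (fun _ => 0)) (glue (fun _ => 1) (fun _ => 1)) (cle f11 f01)
  have g1012 := gm (glue (fun _ => 1) (fun _ => 0)) (glue (fun _ => 1) (fun _ => 2)) (cle f11 f02)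
  have g2021 := gm (glue (fun _ => 2) (fun _ => 0)) (glue (fun _ => 2) (fun _ => 1)) (cle f22 f01)
  have g2022 := gm (glue (fun _ => 2) (fun _ => 0)) (glue (fun _ => 2) (fun _ => 2)) (cle f22 f02)
  -- the nine cell budgets
  have b00 := hcell (glue (fun _ => 0) (fun _ => 0)) 0 0 u00 s00
  have b01 := hcell (glue (fun _ => 0) (fun _ => 1)) 1 4 u01 s01
  have b02 := hcell (glue (fun _ => 0) (fun _ => 2)) 1 4 u02 s02
  have b10 := hcell (glue (fun _ => 1) (fun _ => 0)) 1 2 u10 s10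
  have b11 := hcell (glue (fun _ => 1) (fun _ => 1)) 1 5 u11 s11
  have b12 := hcell (glue (fun _ => 1) (fun _ => 2)) 1 5 u12 s12
  have b20 := hcell (glue (fun _ => 2) (fun _ => 0)) 1 2 u20 s20
  have b21 := hcell (glue (fun _ => 2) (fun _ => 1)) 1 5 u21 s21
  have b22 := hcell (glue (fun _ => 2) (fun _ => 2)) 1 5 u22 s22
  -- nonnegativity of the corner `M`-sum (its coefficient is `0`; harmless) and of all cell `M`-sums
  have hM0 : ∀ σ : Pd (1 + 1), 0 ≤ (2:ℤ) ^ k * ∑ q : Pd k, ind P (glue σ q) * ind Q (glue σ q) * ind V q :=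
    fun σ => mul_nonneg (pow_nonneg (by norm_num) k) (Finset.sum_nonneg fun q _ =>
      mul_nonneg (mul_nonneg (ind_nonneg' P _) (ind_nonneg' Q _)) (ind_nonneg' V q))
  rw [hbud, sum_glue (n := 1) (k := 1), sum_pd1, sum_pd1, sum_pd1, sum_pd1, b00, b01, b02, b10, b11, b12, b20, b21, b22]
  linarith [hdom, p0110, p0112, p0120, p0122, p0210, p0211, p0220, p0221, p1021, p1022, p1120, p1122, p1220, p1221,
    g1011, g1012, g2021, g2022, hM0 (glue (fun _ => 0) (fun _ => 0))]

/-- **COROLLARY (the block product `(x∨y) × V` is nonnegative for the pattern functional at every co-monotone test pair; every `k`).**  With (T) for `d_V`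
in addition (so that the co-count product satisfies (T), `diagCert_coProduct_T`): `0 ≤ sStarD ((x∨y)×V) P Q`. [this work] -/
theorem sStarD_blockAnd_orTwo_nonneg_of_comonotone (hS : ∀ ξ η : Pd 1, glue ξ η ∈ S ↔ (1 ≤ ξ 0 ∨ 1 ≤ η 0))
    (hSu : IsUpperSet (S : Set (Pd (1 + 1)))) (hV : IsUpperSet (V : Set (Pd k))) (hA : ∀ σ z, glue σ z ∈ A ↔ (σ ∈ S ∧ z ∈ V))
    (dS : Pd (1 + 1) → ℤ) (hdS : dS (glue (fun _ => 0) (fun _ => 0)) = 0 ∧ dS (glue (fun _ => 0) (fun _ => 1)) = 4 ∧ dS (glue (fun _ => 0) (fun _ => 2)) = 4 ∧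
      dS (glue (fun _ => 1) (fun _ => 0)) = 2 ∧ dS (glue (fun _ => 1) (fun _ => 1)) = 5 ∧ dS (glue (fun _ => 1) (fun _ => 2)) = 5 ∧
      dS (glue (fun _ => 2) (fun _ => 0)) = 2 ∧ dS (glue (fun _ => 2) (fun _ => 1)) = 5 ∧ dS (glue (fun _ => 2) (fun _ => 2)) = 5)
    (hTS : ∀ W : Finset (Pd (1 + 1)), IsUpperSet (W : Set (Pd (1 + 1))) → (∑ ξ ∈ W, dS ξ) ≤ ∑ ξ ∈ W, lamU S ξ)
    (hmS : ∀ ξ : Pd (1 + 1), dS ξ ≤ 2 * (2:ℤ) ^ (1 + 1) * ind S ξ)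
    (dV : Pd k → ℤ) (hdV : ∀ q, 0 ≤ dV q) (hmV : ∀ q : Pd k, dV q ≤ 2 * (2:ℤ) ^ k * ind V q)
    (hTV : ∀ W : Finset (Pd k), IsUpperSet (W : Set (Pd k)) → (∑ q ∈ W, dV q) ≤ ∑ q ∈ W, lamU V q)
    (hNV : ∀ X X' : Finset (Pd k), IsUpperSet (X : Set (Pd k)) → IsUpperSet (X' : Set (Pd k)) → (∑ q ∈ X, ∑ r ∈ X', thetaVal V q r) ≤ ∑ q ∈ X ∩ X', dV q)
    {P Q : Finset (Pd ((1 + 1) + k))} (hP : IsUpperSet (P : Set (Pd ((1 + 1) + k)))) (hQ : IsUpperSet (Q : Set (Pd ((1 + 1) + k))))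
    (h0110 : (sect P (glue (fun _ => 0) (fun _ => 1)) ⊆ sect P (glue (fun _ => 1) (fun _ => 0)) ∧ sect Q (glue (fun _ => 0) (fun _ => 1)) ⊆ sect Q (glue (fun _ => 1) (fun _ => 0))) ∨ (sect P (glue (fun _ => 1) (fun _ => 0)) ⊆ sect P (glue (fun _ => 0) (fun _ => 1)) ∧ sect Q (glue (fun _ => 1) (fun _ => 0)) ⊆ sect Q (glue (fun _ => 0) (fun _ => 1))))
    (h0120 : (sect P (glue (fun _ => 0) (fun _ => 1)) ⊆ sect P (glue (fun _ => 2) (fun _ => 0)) ∧ sect Q (glue (fun _ => 0) (fun _ => 1)) ⊆ sect Q (glue (fun _ => 2) (fun _ => 0))) ∨ (sect P (glue (fun _ => 2) (fun _ => 0)) ⊆ sect P (glue (fun _ => 0) (fun _ => 1)) ∧ sect Q (glue (fun _ => 2) (fun _ => 0)) ⊆ sect Q (glue (fun _ => 0) (fun _ => 1))))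
    (h0210 : (sect P (glue (fun _ => 0) (fun _ => 2)) ⊆ sect P (glue (fun _ => 1) (fun _ => 0)) ∧ sect Q (glue (fun _ => 0) (fun _ => 2)) ⊆ sect Q (glue (fun _ => 1) (fun _ => 0))) ∨ (sect P (glue (fun _ => 1) (fun _ => 0)) ⊆ sect P (glue (fun _ => 0) (fun _ => 2)) ∧ sect Q (glue (fun _ => 1) (fun _ => 0)) ⊆ sect Q (glue (fun _ => 0) (fun _ => 2))))
    (h0211 : (sect P (glue (fun _ => 0) (fun _ => 2)) ⊆ sect P (glue (fun _ => 1) (fun _ => 1)) ∧ sect Q (glue (fun _ => 0) (fun _ => 2)) ⊆ sect Q (glue (fun _ => 1) (fun _ => 1))) ∨ (sect P (glue (fun _ => 1) (fun _ => 1)) ⊆ sect P (glue (fun _ => 0) (fun _ => 2)) ∧ sect Q (glue (fun _ => 1) (fun _ => 1)) ⊆ sect Q (glue (fun _ => 0) (fun _ => 2))))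
    (h0220 : (sect P (glue (fun _ => 0) (fun _ => 2)) ⊆ sect P (glue (fun _ => 2) (fun _ => 0)) ∧ sect Q (glue (fun _ => 0) (fun _ => 2)) ⊆ sect Q (glue (fun _ => 2) (fun _ => 0))) ∨ (sect P (glue (fun _ => 2) (fun _ => 0)) ⊆ sect P (glue (fun _ => 0) (fun _ => 2)) ∧ sect Q (glue (fun _ => 2) (fun _ => 0)) ⊆ sect Q (glue (fun _ => 0) (fun _ => 2))))
    (h0221 : (sect P (glue (fun _ => 0) (fun _ => 2)) ⊆ sect P (glue (fun _ => 2) (fun _ => 1)) ∧ sect Q (glue (fun _ => 0) (fun _ => 2)) ⊆ sect Q (glue (fun _ => 2) (fun _ => 1))) ∨ (sect P (glue (fun _ => 2) (fun _ => 1)) ⊆ sect P (glue (fun _ => 0) (fun _ => 2)) ∧ sect Q (glue (fun _ => 2) (fun _ => 1)) ⊆ sect Q (glue (fun _ => 0) (fun _ => 2))))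
    (h1120 : (sect P (glue (fun _ => 1) (fun _ => 1)) ⊆ sect P (glue (fun _ => 2) (fun _ => 0)) ∧ sect Q (glue (fun _ => 1) (fun _ => 1)) ⊆ sect Q (glue (fun _ => 2) (fun _ => 0))) ∨ (sect P (glue (fun _ => 2) (fun _ => 0)) ⊆ sect P (glue (fun _ => 1) (fun _ => 1)) ∧ sect Q (glue (fun _ => 2) (fun _ => 0)) ⊆ sect Q (glue (fun _ => 1) (fun _ => 1))))
    (h1220 : (sect P (glue (fun _ => 1) (fun _ => 2)) ⊆ sect P (glue (fun _ => 2) (fun _ => 0)) ∧ sect Q (glue (fun _ => 1) (fun _ => 2)) ⊆ sect Q (glue (fun _ => 2) (fun _ => 0))) ∨ (sect P (glue (fun _ => 2) (fun _ => 0)) ⊆ sect P (glue (fun _ => 1) (fun _ => 2)) ∧ sect Q (glue (fun _ => 2) (fun _ => 0)) ⊆ sect Q (glue (fun _ => 1) (fun _ => 2))))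
    (h1221 : (sect P (glue (fun _ => 1) (fun _ => 2)) ⊆ sect P (glue (fun _ => 2) (fun _ => 1)) ∧ sect Q (glue (fun _ => 1) (fun _ => 2)) ⊆ sect Q (glue (fun _ => 2) (fun _ => 1))) ∨ (sect P (glue (fun _ => 2) (fun _ => 1)) ⊆ sect P (glue (fun _ => 1) (fun _ => 2)) ∧ sect Q (glue (fun _ => 2) (fun _ => 1)) ⊆ sect Q (glue (fun _ => 1) (fun _ => 2)))) :
    0 ≤ sStarD A P Q := by
  rw [sStarD_eq_sum_lamU_sub_sum_thetaVal]
  have hT := diagCert_coProduct_T hA dS dV hTS hTV hmS (isUpperSet_inter_coe hP hQ)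
  have hN := diagCert_coProduct_N_orTwo_of_comonotone hS hSu hV hA dS hdS dV hdV hmV hNV hP hQ
    h0110 h0120 h0210 h0211 h0220 h0221 h1120 h1220 h1221
  linarith

end OrTwo

end Summit.CriticalPhenomena.PercolationContinuityZ3.Theorems.SahiGridPattern
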